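import Literature.ComputerArithmetic.Higham2002.Summation
import Literature.ComputerArithmetic.GraillatJezequel2020.CompensatedEnclosures

/-!
# Accuracy of compensated summation and of the compensated dot product, under rounding to
nearest and under a directed rounding (Graillat–Jézéquel–Picot 2018)

HONEST FRAMING (ENGINES group, unit `eng-quad-4`, kernels lane of the `certquad` engine — shared
numerical engines serving client cells; rigour lives in the verifiers; every published number
belongs to a client cell's ledger, not to the engines group): the kernels run compensated
summation / dot products both under rounding to nearest and under a directed rounding (the latter
for enclosures, `GraillatJezequel2020/CompensatedEnclosures.lean`). This file types and PROVES,
in MODEL form exactly as `Higham2002/Summation.lean` and `LangloisLouvet2006/CompHorner.lean`,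
the published ACCURACY bounds of those runs. No hardware, vendor, timing or format claims; the
format-level facts of the source (the standard model of one rounded operation, the exactness or
near-exactness of the error-free transformations, absence of underflow for products) are
HYPOTHESES here, to be discharged per format elsewhere.

Source read at the page: [GraillatJezequelPicot2018] (Appl. Math. Comput. 329 (2018) 339–363),
Sections 2, 4 and 5; the numbering of propositions and equations is the journal's. The results
the source recalls from its references are cited there as: PROPOSITION 4.1 = [11] (Higham),
PROPOSITIONS 4.3, 5.3 and COROLLARIES 4.4, 5.4 = [20] (Ogita–Rump–Oishi 2005, `Sum2` / `Dot2`),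
PROPOSITION 4.5, LEMMA 4.6, PROPOSITION 4.7 = [8] (Graillat–Jézéquel–Picot 2015);
PROPOSITION 4.7 and PROPOSITION 5.5 are also PROPOSITIONS 4.4 and 5.4 of [GraillatJezequel2020].

THE MODEL (ordered field `K`).
* `v ≥ 0` bounds the relative error of ONE rounded operation, in the additive form
  `|fl(t) - t| ≤ v |t|` of [GraillatJezequelPicot2018, §2 eq. (2.2)]: `v = u` under rounding to
  nearest, `v = 2u` under a directed rounding. Every rounded operation of an algorithm is a TRACE
  hypothesis `|computed - exact| ≤ v |exact|` on arbitrary sequences (as the `hπ`, `hσ` of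
  `LangloisLouvet2006/CompHorner.lean`), so one theorem serves both rounding regimes.
* `w ≥ 0` bounds the inexactness of the error-free transformation of the SUM: with `e` the exact
  error of a rounded addition and `q` the computed correction, `|q - e| ≤ w |e|`. `w = 0` for an
  exact transformation (`TwoSum` / `FastTwoSum` under rounding to nearest, §4.2; `PriestTwoSum`
  under any rounding, §4.3 Algorithms 4–5), `w = 2u = v` for `FastTwoSum` under a directed
  rounding (PROPOSITION 4.5, `|e - d| ≤ 2u |e|`). `TwoProdFMA` is exact under any rounding barring
  underflow (§5.2), so the product residual is the exact `rᵢ = xᵢ yᵢ - hᵢ`.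
* Indexation: `n + 1` summands `p₀ … pₙ` (resp. products `x₀y₀ … xₙyₙ`), hence `n` compensated
  steps with exact addition errors `eᵢ = πᵢ + pᵢ₊₁ - πᵢ₊₁` and corrections `q₀ … qₙ₋₁`; the
  printed `n` (number of summands) is our `n + 1`, so the printed `γₙ₋₁` is our `γₙ`, etc. The
  accumulation of the corrections is `σ₀ = 0`, `|σᵢ₊₁ - (σᵢ + qᵢ)| ≤ v |σᵢ + qᵢ|` for EVERY
  `i < n`: the first step `σ₁ = fl(0 + q₀) = q₀` is exact in floating point and the source does not
  count it; the model counts it (one more factor `1 + v`), which the printed constants absorb —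
  every printed bound below is reached as printed.

Typed and PROVED:

* §2 REMARK 1 and §4.3 eq. (4.12) — `gamma_le_gamma_succ` (`γₘ ≤ γₘ₊₁`),
  `one_add_mul_gamma_le_gamma_succ` (`(1 + v) γₘ ≤ γₘ₊₁`), and the form in which the proofs
  below consume them, `one_add_mul_pow_sub_one_le_gamma` (`(1 + v)((1 + v)ᵐ - 1) ≤ γₘ`).
* PROPOSITION 4.1 ([11]; eqs. (4.3)/(4.4)) in trace form — `abs_acc_sub_le` (sharp:
  `((1 + v)ᵐ - 1) ·`) and `abs_sumTrace_sub_sum_le_gamma` (`|res - s| ≤ γₙ(v) S`).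
* LEMMA 4.6 ([8]; eq. (4.5)) — `sum_abs_err_le` (sharp) and `sum_abs_err_le_gamma`
  (`Σ |eᵢ| ≤ γₙ(v) S`), for any trace of the rounded recursive sum.
* The common engine of the proofs of PROPOSITIONS 4.3, 4.7, 4.10 — `abs_compSum_sub_sum_le`:
  `|res - s| ≤ v |s| + (1 + v)(w + (1 + w)((1 + v)ⁿ - 1))((1 + v)ⁿ - 1) S`.
* PROPOSITION 4.3 ([20], `v = u`) and PROPOSITION 4.10 (eq. (4.9), `v = 2u`), exact
  transformation — `abs_compSum_sub_sum_le_gamma_sq`: `|res - s| ≤ v |s| + γₙ(v)² S`;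
  COROLLARIES 4.4 / 4.11 — `abs_compSum_sub_sum_div_le`.
* PROPOSITION 4.7 ([8]; = [GraillatJezequel2020] PROPOSITION 4.4), `FastCompSum` under a directed
  rounding — `abs_fastCompSum_trace_sub_sum_le`: `|res - s| ≤ v |s| + 2(1 + v) γₙ₊₁(v)² S`, and
  LITERALLY for `GraillatJezequel2020.fastCompSum rd p n` under `|rd t - t| ≤ v |t|` —
  `abs_fastCompSum_sub_sum_le`; COROLLARY 4.8 — `abs_fastCompSum_sub_sum_div_le`.
* PROPOSITION 5.1 ([11]; eqs. (5.13)/(5.14)) in trace form — `abs_dotTrace_sub_dot_le_gamma`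
  (`|res - xᵀy| ≤ γₙ₊₁(v) |x|ᵀ|y|`).
* The common engine of the proofs of PROPOSITIONS 5.3, 5.5 (eqs. (5.16)–(5.29)) —
  `abs_compDot_sub_dot_le`.
* PROPOSITION 5.3 ([20], `v = u`, eq. (5.15)) — `abs_compDot_sub_dot_le_gamma_sq`:
  `|res - xᵀy| ≤ v |xᵀy| + γₙ₊₁(v)² |x|ᵀ|y|`; COROLLARY 5.4 — `abs_compDot_sub_dot_div_le`.
* PROPOSITION 5.5 (`v = 2u`; the bound of [GraillatJezequel2020] PROPOSITION 5.4) —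
  `abs_compDotDir_sub_dot_le`: `|res - xᵀy| ≤ v |xᵀy| + 2 γₙ₊₂(v)² |x|ᵀ|y|`, and LITERALLY for
  `GraillatJezequel2020.compDotRd rd cr x y n` with the model `FastTwoSum` correction
  `cr a b = rd (a + b - rd (a + b))` (Algorithms 8/9) — `abs_compDotRd_sub_dot_le`;
  COROLLARY 5.6 — `abs_compDotRd_sub_dot_div_le`.

NOT formalised here: §3 (DSA / CADNA), the format-level proofs of PROPOSITION 4.5 and of the
exactness of the transformations (hypotheses `w`, `hq`, `r`), LEMMA 4.9, §6 (compensated Horner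
under a directed rounding, THEOREM 6.4), §§7–8 (`SumK`, `DotK`), §9 (experiments).
-/

namespace Literature.ComputerArithmetic.GraillatJezequelPicot2018

open Finset Literature.ComputerArithmetic.Higham2002
open Literature.ComputerArithmetic.GraillatJezequel2020

variable {K : Type*} [Field K] [LinearOrder K] [IsStrictOrderedRing K]

/-! ## Section 2, Remark 1: relations between the constants `γₘ(v) = m v / (1 - m v)` -/

/-- REMARK 1, second relation: `γₘ(v) ≤ γₘ₊₁(v)` (`(m + 1) v < 1`).
[cite: GraillatJezequelPicot2018, §2 Remark 1] -/
theorem gamma_le_gamma_succ {v : K} (hv : 0 ≤ v) {m : ℕ} (hm : ((m + 1 : ℕ) : K) * v < 1) :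
    gamma v m ≤ gamma v (m + 1) := by
  have hmv : 0 ≤ (m : K) * v := mul_nonneg (Nat.cast_nonneg m) hv
  have hm1 : ((m : K) + 1) * v < 1 := by push_cast at hm; exact hm
  have hm0 : (m : K) * v < 1 := by linarith
  unfold gamma
  push_cast
  rw [div_le_div_iff₀ (by linarith) (by linarith)]
  nlinarith

/-- REMARK 1, third relation, and eq. (4.12): `(1 + v) γₘ(v) ≤ γₘ₊₁(v)` (`(m + 1) v < 1`; printed
for `v = u` in Remark 1 and for `v = 2u` as eq. (4.12), `(1 + 2u) γₙ₋₁(2u) < γₙ(2u)`).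
[cite: GraillatJezequelPicot2018, §2 Remark 1; §4.3 eq. (4.12)] -/
theorem one_add_mul_gamma_le_gamma_succ {v : K} (hv : 0 ≤ v) {m : ℕ}
    (hm : ((m + 1 : ℕ) : K) * v < 1) : (1 + v) * gamma v m ≤ gamma v (m + 1) := by
  have hmv : 0 ≤ (m : K) * v := mul_nonneg (Nat.cast_nonneg m) hv
  have hm1 : ((m : K) + 1) * v < 1 := by push_cast at hm; exact hm
  have hm0 : (m : K) * v < 1 := by linarith
  unfold gamma
  push_cast
  rw [mul_div_assoc', div_le_div_iff₀ (by linarith) (by linarith)]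
  nlinarith [mul_nonneg (mul_nonneg hmv hmv) hv, mul_nonneg (mul_nonneg hmv hv) hv,
    mul_nonneg hv (sub_nonneg.mpr hm0.le)]

/-- The form of REMARK 1 / eq. (4.12) consumed below: `(1 + v)((1 + v)ᵐ - 1) ≤ γₘ(v)` for
`m v < 1` (the model bounds carry `(1 + v)ᵐ - 1 ≤ γₘ(v)`, Higham's Lemma 3.1, and one factor
`1 + v` from the final rounding; this inequality turns `(1 + v)((1 + v)ᵐ - 1) γₘ` into the
printed `γₘ²`, as eq. (4.12) turns `(1 + 2u) γₙ₋₂ γₙ₋₁` into `γₙ₋₁²` in the proof of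
Proposition 4.10). Proof: `B (1 - m v) ≤ m v` for `B = (1 + v)ᵐ⁺¹ - (1 + v)` by induction.
[cite: GraillatJezequelPicot2018, §2 Remark 1; §4.3 eq. (4.12) and proof of Proposition 4.10] -/
theorem one_add_mul_pow_sub_one_le_gamma {v : K} (hv : 0 ≤ v) {m : ℕ} (hm : (m : K) * v < 1) :
    (1 + v) * ((1 + v) ^ m - 1) ≤ gamma v m := by
  have key : ∀ m : ℕ, ((1 + v) ^ (m + 1) - (1 + v)) * (1 - (m : K) * v) ≤ (m : K) * v := by
    intro m
    induction m with
    | zero => simp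
    | succ m ih =>
        set B := (1 + v) ^ (m + 1) - (1 + v) with hB
        have hB0 : 0 ≤ B := by
          have h1 : (1 + v) ^ 1 ≤ (1 + v) ^ (m + 1) :=
            pow_le_pow_right₀ (by linarith) (Nat.succ_le_succ (Nat.zero_le m))
          rw [hB]; linarith [pow_one (1 + v)]
        have e : (1 + v) ^ (m + 1 + 1) - (1 + v) = (1 + v) * B + v * (1 + v) := by
          rw [hB]; ring
        rw [e]
        push_cast
        rcases le_total 0 (1 - ((m : K) + 1) * v) with hc | hc
        · have h1 : B * (1 - ((m : K) + 1) * v) ≤ (m : K) * v - v * B := by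
            have e1 : B * (1 - ((m : K) + 1) * v) = B * (1 - (m : K) * v) - v * B := by ring
            rw [e1]; linarith [ih]
          have h2 := mul_le_mul_of_nonneg_left h1 (show (0 : K) ≤ 1 + v by linarith)
          nlinarith [h2, mul_nonneg hv hB0, mul_nonneg (mul_nonneg hv hv) hB0, pow_nonneg hv 3,
            mul_nonneg (pow_nonneg hv 3) (Nat.cast_nonneg m)]
        · have h1 : ((1 + v) * B + v * (1 + v)) * (1 - ((m : K) + 1) * v) ≤ 0 :=
            mul_nonpos_of_nonneg_of_nonpos
              (add_nonneg (mul_nonneg (by linarith) hB0) (mul_nonneg hv (by linarith))) hc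
          have h2 : 0 ≤ ((m : K) + 1) * v := by positivity
          linarith
  have hpos : 0 < 1 - (m : K) * v := by linarith
  unfold gamma
  rw [le_div_iff₀ hpos]
  have e : (1 + v) * ((1 + v) ^ m - 1) = (1 + v) ^ (m + 1) - (1 + v) := by ring
  rw [e]
  exact key m

/-! ## Section 4.1, Proposition 4.1: recursive accumulation under one rounding per addition -/

/-- PROOF OF PROPOSITION 4.1 ([11]), sharp trace form. An accumulation `a₀ = c`,
`|aₖ₊₁ - (aₖ + dₖ)| ≤ v |aₖ + dₖ|` (`k < m`: `m` rounded additions) satisfies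
`|aₘ - (c + Σ_{k<m} dₖ)| ≤ ((1 + v)ᵐ - 1)(|c| + Σ_{k<m} |dₖ|)`. Used for the recursive sum itself
(`c = p₀`, `dₖ = pₖ₊₁`), for the accumulated corrections (`c = 0`, `dₖ = qₖ`) and for line 5 of
Algorithm 9 (`c = r₀`, `dₖ = fl(qₖ + rₖ₊₁)`, eq. (5.26)).
[cite: GraillatJezequelPicot2018, §4.1 Proposition 4.1] [cite: Higham2002ASNA, §4.2 eq. (4.3)] -/
theorem abs_acc_sub_le {v : K} (hv : 0 ≤ v) (c : K) (d a : ℕ → K) (h0 : a 0 = c) :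
    ∀ m : ℕ, (∀ k < m, |a (k + 1) - (a k + d k)| ≤ v * |a k + d k|) →
      |a m - (c + ∑ k ∈ range m, d k)| ≤ ((1 + v) ^ m - 1) * (|c| + ∑ k ∈ range m, |d k|)
  | 0, _ => by simp [h0]
  | m + 1, hstep => by
      have ih := abs_acc_sub_le hv c d a h0 m fun k hk => hstep k (Nat.lt_succ_of_lt hk)
      have hd : |a (m + 1) - (a m + d m)| ≤ v * |a m + d m| := hstep m (Nat.lt_succ_self m)
      set S := c + ∑ k ∈ range m, d k with hS
      set A := |c| + ∑ k ∈ range m, |d k| with hA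
      have hSA : |S| ≤ A :=
        le_trans (abs_add_le _ _) (add_le_add le_rfl (Finset.abs_sum_le_sum_abs _ _))
      rw [Finset.sum_range_succ d m, Finset.sum_range_succ (fun k => |d k|) m, ← add_assoc,
        ← add_assoc, ← hS, ← hA]
      have key : a (m + 1) - (S + d m) = (a (m + 1) - (a m + d m)) + (a m - S) := by ring
      rw [key]
      have h1 : |a m + d m| ≤ (1 + v) ^ m * A + |d m| := by
        have e : a m + d m = (a m - S) + S + d m := by ring
        rw [e]
        calc |a m - S + S + d m| ≤ |a m - S| + |S| + |d m| := abs_add_three _ _ _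
          _ ≤ ((1 + v) ^ m - 1) * A + A + |d m| := add_le_add (add_le_add ih hSA) le_rfl
          _ = (1 + v) ^ m * A + |d m| := by ring
      have hvle : v ≤ (1 + v) ^ (m + 1) - 1 := le_one_add_pow_succ_sub_one hv m
      calc |a (m + 1) - (a m + d m) + (a m - S)|
          ≤ |a (m + 1) - (a m + d m)| + |a m - S| := abs_add_le _ _
        _ ≤ v * ((1 + v) ^ m * A + |d m|) + ((1 + v) ^ m - 1) * A :=
            add_le_add (le_trans hd (mul_le_mul_of_nonneg_left h1 hv)) ih
        _ = ((1 + v) ^ (m + 1) - 1) * A + v * |d m| := by ring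
        _ ≤ ((1 + v) ^ (m + 1) - 1) * A + ((1 + v) ^ (m + 1) - 1) * |d m| :=
            add_le_add le_rfl (mul_le_mul_of_nonneg_right hvle (abs_nonneg _))
        _ = ((1 + v) ^ (m + 1) - 1) * (A + |d m|) := by ring

/-- PROPOSITION 4.1 ([11]) as printed, trace form: a rounded recursive summation `π₀ = p₀`,
`|πᵢ₊₁ - (πᵢ + pᵢ₊₁)| ≤ v |πᵢ + pᵢ₊₁|` of `p₀ … pₙ` with `n v < 1` returns `res = πₙ` with
`|res - s| ≤ γₙ(v) S`, `s = Σ pᵢ`, `S = Σ |pᵢ|` — eq. (4.3) for `v = u` (rounding to nearest) and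
eq. (4.4) for `v = 2u` (directed rounding); printed `γₙ₋₁` for `n` summands.
[cite: GraillatJezequelPicot2018, §4.1 Proposition 4.1 eqs. (4.3)–(4.4)]
[cite: Higham2002ASNA, §4.2 eq. (4.4)] -/
theorem abs_sumTrace_sub_sum_le_gamma {v : K} (hv : 0 ≤ v) {n : ℕ} (hn : (n : K) * v < 1)
    (p π : ℕ → K) (hπ0 : π 0 = p 0)
    (hπ : ∀ i < n, |π (i + 1) - (π i + p (i + 1))| ≤ v * |π i + p (i + 1)|) :
    |π n - ∑ i ∈ range (n + 1), p i| ≤ gamma v n * ∑ i ∈ range (n + 1), |p i| := by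
  have h := abs_acc_sub_le hv (p 0) (fun k => p (k + 1)) π hπ0 n hπ
  rw [Finset.sum_range_succ' p n, Finset.sum_range_succ' (fun i => |p i|) n, add_comm _ (p 0),
    add_comm _ |p 0|]
  exact le_trans h (mul_le_mul_of_nonneg_right (one_add_pow_sub_one_le_gamma hv hn)
    (add_nonneg (abs_nonneg _) (Finset.sum_nonneg fun _ _ => abs_nonneg _)))

/-! ## Section 4.3, Lemma 4.6: the sum of the exact addition errors -/

/-- PROOF OF LEMMA 4.6 ([8]), sharp trace form: for a rounded recursive summation `π₀ = p₀`,
`|πᵢ₊₁ - (πᵢ + pᵢ₊₁)| ≤ v |πᵢ + pᵢ₊₁|`, the exact addition errors `eᵢ = πᵢ + pᵢ₊₁ - πᵢ₊₁`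
satisfy `Σ_{i<n} |eᵢ| ≤ ((1 + v)ⁿ - 1) Σ_{i≤n} |pᵢ|` (induction with `|πₙ| ≤ Σ |pᵢ| + Σ |eᵢ|` from
`s = πₙ + Σ eᵢ`). [cite: GraillatJezequelPicot2018, §4.3 Lemma 4.6 eq. (4.5)]
[cite: GraillatJezequelPicot2015] -/
theorem sum_abs_err_le {v : K} (hv : 0 ≤ v) (p π : ℕ → K) (hπ0 : π 0 = p 0) :
    ∀ n : ℕ, (∀ i < n, |π (i + 1) - (π i + p (i + 1))| ≤ v * |π i + p (i + 1)|) →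
      ∑ i ∈ range n, |π i + p (i + 1) - π (i + 1)|
        ≤ ((1 + v) ^ n - 1) * ∑ i ∈ range (n + 1), |p i|
  | 0, _ => by simp
  | n + 1, hstep => by
      have ih := sum_abs_err_le hv p π hπ0 n fun i hi => hstep i (Nat.lt_succ_of_lt hi)
      have hid := sum_eq_acc_add_sum_err p π hπ0 n
      set S := ∑ i ∈ range (n + 1), p i with hS
      set A := ∑ i ∈ range (n + 1), |p i| with hA
      set E := ∑ i ∈ range n, |π i + p (i + 1) - π (i + 1)| with hE
      have hSA : |S| ≤ A := Finset.abs_sum_le_sum_abs _ _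
      rw [Finset.sum_range_succ (fun i => |π i + p (i + 1) - π (i + 1)|) n,
        Finset.sum_range_succ (fun i => |p i|) (n + 1), ← hE, ← hA]
      have hπn : |π n| ≤ A + E := by
        have e : π n = S - ∑ i ∈ range n, (π i + p (i + 1) - π (i + 1)) := by rw [hid]; ring
        rw [e]
        exact le_trans (abs_sub _ _) (add_le_add hSA (Finset.abs_sum_le_sum_abs _ _))
      have hπn' : |π n| ≤ (1 + v) ^ n * A := by nlinarith [hπn, ih]
      have hen : |π n + p (n + 1) - π (n + 1)| ≤ v * (|π n| + |p (n + 1)|) := by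
        rw [abs_sub_comm]
        exact le_trans (hstep n (Nat.lt_succ_self n))
          (mul_le_mul_of_nonneg_left (abs_add_le _ _) hv)
      have hvle : v ≤ (1 + v) ^ (n + 1) - 1 := le_one_add_pow_succ_sub_one hv n
      calc E + |π n + p (n + 1) - π (n + 1)| ≤ E + v * (|π n| + |p (n + 1)|) :=
            add_le_add le_rfl hen
        _ ≤ ((1 + v) ^ n - 1) * A + v * ((1 + v) ^ n * A + |p (n + 1)|) :=
            add_le_add ih (mul_le_mul_of_nonneg_left (add_le_add hπn' le_rfl) hv)
        _ = ((1 + v) ^ (n + 1) - 1) * A + v * |p (n + 1)| := by ring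
        _ ≤ ((1 + v) ^ (n + 1) - 1) * A + ((1 + v) ^ (n + 1) - 1) * |p (n + 1)| :=
            add_le_add le_rfl (mul_le_mul_of_nonneg_right hvle (abs_nonneg _))
        _ = ((1 + v) ^ (n + 1) - 1) * (A + |p (n + 1)|) := by ring

/-- LEMMA 4.6 ([8]) as printed: with `n v < 1`, `Σ_{i<n} |eᵢ| ≤ γₙ(v) Σ_{i≤n} |pᵢ|` for the exact
addition errors of a rounded recursive summation of `p₀ … pₙ` (printed for `FastCompSum` under a
directed rounding, `v = 2u`, `γₙ₋₁(2u)` for `n` summands; the statement only concerns the high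
parts `πᵢ`, i.e. Algorithm 1 run under that rounding, and holds verbatim for `v = u`).
[cite: GraillatJezequelPicot2018, §4.3 Lemma 4.6 eq. (4.5)] [cite: GraillatJezequelPicot2015] -/
theorem sum_abs_err_le_gamma {v : K} (hv : 0 ≤ v) {n : ℕ} (hn : (n : K) * v < 1) (p π : ℕ → K)
    (hπ0 : π 0 = p 0) (hπ : ∀ i < n, |π (i + 1) - (π i + p (i + 1))| ≤ v * |π i + p (i + 1)|) :
    ∑ i ∈ range n, |π i + p (i + 1) - π (i + 1)| ≤ gamma v n * ∑ i ∈ range (n + 1), |p i| :=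
  le_trans (sum_abs_err_le hv p π hπ0 n hπ) (mul_le_mul_of_nonneg_right
    (one_add_pow_sub_one_le_gamma hv hn) (Finset.sum_nonneg fun _ _ => abs_nonneg _))

/-! ## Bookkeeping: a correction within relative distance `w` of the exact error -/

/-- The step "`Σ |qᵢ - eᵢ| ≤ w Σ |eᵢ|`, hence `Σ |qᵢ| ≤ (1 + w) Σ |eᵢ|`" (eqs. (5.23)–(5.25) with
`w = 2u`; also used for `cᵢ = fl(qᵢ + rᵢ₊₁)` with `w = v`, the display after eq. (5.26)).
[cite: GraillatJezequelPicot2018, §5.3 proof of Proposition 5.5, eqs. (5.23)–(5.26)] -/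
theorem sum_abs_corr_le {w : K} (n : ℕ) (q e : ℕ → K) (hq : ∀ i < n, |q i - e i| ≤ w * |e i|) :
    ∑ i ∈ range n, |q i - e i| ≤ w * ∑ i ∈ range n, |e i|
      ∧ ∑ i ∈ range n, |q i| ≤ (1 + w) * ∑ i ∈ range n, |e i| := by
  have h1 : ∑ i ∈ range n, |q i - e i| ≤ w * ∑ i ∈ range n, |e i| := by
    rw [Finset.mul_sum]
    exact Finset.sum_le_sum fun i hi => hq i (Finset.mem_range.mp hi)
  refine ⟨h1, ?_⟩
  have hpt : ∀ i ∈ range n, |q i| ≤ |q i - e i| + |e i| := by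
    intro i _
    have h := abs_add_le (q i - e i) (e i)
    rwa [sub_add_cancel] at h
  calc ∑ i ∈ range n, |q i| ≤ ∑ i ∈ range n, (|q i - e i| + |e i|) := Finset.sum_le_sum hpt
    _ = ∑ i ∈ range n, |q i - e i| + ∑ i ∈ range n, |e i| := Finset.sum_add_distrib
    _ ≤ w * ∑ i ∈ range n, |e i| + ∑ i ∈ range n, |e i| := add_le_add h1 le_rfl
    _ = (1 + w) * ∑ i ∈ range n, |e i| := by ring

/-! ## Sections 4.2–4.3: compensated summation (Algorithms 3 and 5), the common engine -/

/-- PROOFS OF PROPOSITIONS 4.3, 4.7 AND 4.10, common trace form. Compensated summation of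
`p₀ … pₙ`: high parts `π₀ = p₀`, `|πᵢ₊₁ - (πᵢ + pᵢ₊₁)| ≤ v |πᵢ + pᵢ₊₁|`, exact errors
`eᵢ = πᵢ + pᵢ₊₁ - πᵢ₊₁`, computed corrections `|qᵢ - eᵢ| ≤ w |eᵢ|`, accumulated corrections
`σ₀ = 0`, `|σᵢ₊₁ - (σᵢ + qᵢ)| ≤ v |σᵢ + qᵢ|`, result `|res - (πₙ + σₙ)| ≤ v |πₙ + σₙ|`. Then
`|res - s| ≤ v |s| + (1 + v)(w + (1 + w)((1 + v)ⁿ - 1))((1 + v)ⁿ - 1) S` — from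
`s = πₙ + Σ eᵢ` (eq. (4.10)), `Σ |eᵢ| ≤ ((1 + v)ⁿ - 1) S` (Lemma 4.6),
`|σₙ - Σ qᵢ| ≤ ((1 + v)ⁿ - 1) Σ |qᵢ|` (Proposition 4.1) and
`|res - s| ≤ (1 + v)|πₙ + σₙ - s| + v |s|` (eq. (4.11)).
[cite: GraillatJezequelPicot2018, §4.3 proof of Proposition 4.10, eqs. (4.6)–(4.11)]
[cite: OgitaRumpOishi2005] -/
theorem abs_compSum_sub_sum_le {v w : K} (hv : 0 ≤ v) (hw : 0 ≤ w) (n : ℕ) (p π q σ : ℕ → K)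
    (res : K) (hπ0 : π 0 = p 0)
    (hπ : ∀ i < n, |π (i + 1) - (π i + p (i + 1))| ≤ v * |π i + p (i + 1)|)
    (hq : ∀ i < n, |q i - (π i + p (i + 1) - π (i + 1))| ≤ w * |π i + p (i + 1) - π (i + 1)|)
    (hσ0 : σ 0 = 0) (hσ : ∀ i < n, |σ (i + 1) - (σ i + q i)| ≤ v * |σ i + q i|)
    (hres : |res - (π n + σ n)| ≤ v * |π n + σ n|) :
    |res - ∑ i ∈ range (n + 1), p i|
      ≤ v * |∑ i ∈ range (n + 1), p i|
        + (1 + v) * (w + (1 + w) * ((1 + v) ^ n - 1)) * ((1 + v) ^ n - 1)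
          * ∑ i ∈ range (n + 1), |p i| := by
  have hid := sum_eq_acc_add_sum_err p π hπ0 n
  have hE := sum_abs_err_le hv p π hπ0 n hπ
  set s := ∑ i ∈ range (n + 1), p i with hs
  set S := ∑ i ∈ range (n + 1), |p i| with hS
  set g := (1 + v) ^ n - 1 with hg
  set E := ∑ i ∈ range n, |π i + p (i + 1) - π (i + 1)| with hEdef
  have hg0 : 0 ≤ g := by
    have := one_le_pow₀ (M₀ := K) (a := 1 + v) (by linarith) (n := n); rw [hg]; linarith
  have hS0 : 0 ≤ S := Finset.sum_nonneg fun _ _ => abs_nonneg _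
  -- `Σ |qᵢ - eᵢ| ≤ w E` and `Σ |qᵢ| ≤ (1 + w) E`
  have hqe : ∑ i ∈ range n, |q i - (π i + p (i + 1) - π (i + 1))| ≤ w * E :=
    (sum_abs_corr_le n q (fun i => π i + p (i + 1) - π (i + 1)) hq).1
  have hqabs : ∑ i ∈ range n, |q i| ≤ (1 + w) * E :=
    (sum_abs_corr_le n q (fun i => π i + p (i + 1) - π (i + 1)) hq).2
  -- the accumulated corrections (Proposition 4.1 with `c = 0`, `dₖ = qₖ`)
  have hσacc : |σ n - ∑ i ∈ range n, q i| ≤ g * ∑ i ∈ range n, |q i| := by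
    have h := abs_acc_sub_le hv 0 q σ hσ0 n hσ
    rwa [zero_add, abs_zero, zero_add] at h
  -- `πₙ + σₙ - s = (σₙ - Σ qᵢ) + Σ (qᵢ - eᵢ)`
  have hD : |π n + σ n - s| ≤ (w + (1 + w) * g) * E := by
    have e1 : π n + σ n - s = (σ n - ∑ i ∈ range n, q i)
        + ∑ i ∈ range n, (q i - (π i + p (i + 1) - π (i + 1))) := by
      rw [Finset.sum_sub_distrib (f := q) (g := fun i => π i + p (i + 1) - π (i + 1)), hid]
      ring
    rw [e1]
    calc |σ n - ∑ i ∈ range n, q i + ∑ i ∈ range n, (q i - (π i + p (i + 1) - π (i + 1)))|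
        ≤ |σ n - ∑ i ∈ range n, q i|
            + |∑ i ∈ range n, (q i - (π i + p (i + 1) - π (i + 1)))| := abs_add_le _ _
      _ ≤ g * ∑ i ∈ range n, |q i| + ∑ i ∈ range n, |q i - (π i + p (i + 1) - π (i + 1))| :=
          add_le_add hσacc (Finset.abs_sum_le_sum_abs _ _)
      _ ≤ g * ((1 + w) * E) + w * E := add_le_add (mul_le_mul_of_nonneg_left hqabs hg0) hqe
      _ = (w + (1 + w) * g) * E := by ring
  -- the final rounding, eq. (4.11)
  have hfin : |π n + σ n| ≤ |s| + |π n + σ n - s| := by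
    have e : |π n + σ n| = |s + (π n + σ n - s)| := by congr 1; ring
    rw [e]; exact abs_add_le _ _
  have key : res - s = (res - (π n + σ n)) + (π n + σ n - s) := by ring
  rw [key]
  have hc0 : 0 ≤ w + (1 + w) * g := add_nonneg hw (mul_nonneg (by linarith) hg0)
  calc |res - (π n + σ n) + (π n + σ n - s)|
      ≤ |res - (π n + σ n)| + |π n + σ n - s| := abs_add_le _ _
    _ ≤ v * (|s| + |π n + σ n - s|) + |π n + σ n - s| :=
        add_le_add (le_trans hres (mul_le_mul_of_nonneg_left hfin hv)) le_rfl
    _ = v * |s| + (1 + v) * |π n + σ n - s| := by ring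
    _ ≤ v * |s| + (1 + v) * ((w + (1 + w) * g) * (g * S)) :=
        add_le_add le_rfl (mul_le_mul_of_nonneg_left
          (le_trans hD (mul_le_mul_of_nonneg_left hE hc0)) (by linarith))
    _ = (v * |s|) + (1 + v) * (w + (1 + w) * g) * g * S := by ring

/-- PROPOSITION 4.3 ([20], rounding to nearest, `v = u`: `FastCompSum`, Algorithm 3, whose
`FastTwoSum` is then exact) and PROPOSITION 4.10 (directed rounding, `v = 2u`: `PriestCompSum`,
Algorithm 5, `PriestTwoSum` exact under any rounding), trace form with an EXACT transformation
`qᵢ = eᵢ`: with `n v < 1`, `|res - s| ≤ v |s| + γₙ(v)² S` (printed `γₙ₋₁²` for `n` summands;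
"also in the presence of underflow" is a format-level remark).
[cite: GraillatJezequelPicot2018, §4.2 Proposition 4.3; §4.3 Proposition 4.10 eq. (4.9)]
[cite: OgitaRumpOishi2005] -/
theorem abs_compSum_sub_sum_le_gamma_sq {v : K} (hv : 0 ≤ v) {n : ℕ} (hn : (n : K) * v < 1)
    (p π q σ : ℕ → K) (res : K) (hπ0 : π 0 = p 0)
    (hπ : ∀ i < n, |π (i + 1) - (π i + p (i + 1))| ≤ v * |π i + p (i + 1)|)
    (hq : ∀ i < n, q i = π i + p (i + 1) - π (i + 1))
    (hσ0 : σ 0 = 0) (hσ : ∀ i < n, |σ (i + 1) - (σ i + q i)| ≤ v * |σ i + q i|)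
    (hres : |res - (π n + σ n)| ≤ v * |π n + σ n|) :
    |res - ∑ i ∈ range (n + 1), p i|
      ≤ v * |∑ i ∈ range (n + 1), p i| + gamma v n ^ 2 * ∑ i ∈ range (n + 1), |p i| := by
  have h := abs_compSum_sub_sum_le hv le_rfl n p π q σ res hπ0 hπ
    (fun i hi => by rw [hq i hi, sub_self, abs_zero, zero_mul]) hσ0 hσ hres
  have hg0 : 0 ≤ (1 + v) ^ n - 1 := by
    have := one_le_pow₀ (M₀ := K) (a := 1 + v) (by linarith) (n := n); linarith
  have hS0 : (0 : K) ≤ ∑ i ∈ range (n + 1), |p i| := Finset.sum_nonneg fun _ _ => abs_nonneg _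
  have h1 : (1 + v) * ((1 + v) ^ n - 1) ≤ gamma v n := one_add_mul_pow_sub_one_le_gamma hv hn
  have h2 : (1 + v) ^ n - 1 ≤ gamma v n := one_add_pow_sub_one_le_gamma hv hn
  refine le_trans h (add_le_add le_rfl ?_)
  have e : (1 + v) * (0 + (1 + 0) * ((1 + v) ^ n - 1)) * ((1 + v) ^ n - 1)
      = ((1 + v) * ((1 + v) ^ n - 1)) * ((1 + v) ^ n - 1) := by ring
  rw [e, sq]
  exact mul_le_mul_of_nonneg_right (mul_le_mul h1 h2 hg0 (gamma_nonneg hv hn)) hS0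

/-- COROLLARY 4.4 ([20], `v = u`) and COROLLARY 4.11 (`v = 2u`): the relative form
`|res - s| / |s| ≤ v + γₙ(v)² cond(Σ pᵢ)`, `cond(Σ pᵢ) = S / |s|` (COROLLARY 4.2); for `s = 0`
the left side is `0` by `x / 0 = 0`.
[cite: GraillatJezequelPicot2018, §4.2 Corollary 4.4; §4.3 Corollary 4.11] -/
theorem abs_compSum_sub_sum_div_le {v : K} (hv : 0 ≤ v) {n : ℕ} (hn : (n : K) * v < 1)
    (p π q σ : ℕ → K) (res : K) (hπ0 : π 0 = p 0)
    (hπ : ∀ i < n, |π (i + 1) - (π i + p (i + 1))| ≤ v * |π i + p (i + 1)|)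
    (hq : ∀ i < n, q i = π i + p (i + 1) - π (i + 1))
    (hσ0 : σ 0 = 0) (hσ : ∀ i < n, |σ (i + 1) - (σ i + q i)| ≤ v * |σ i + q i|)
    (hres : |res - (π n + σ n)| ≤ v * |π n + σ n|) :
    |res - ∑ i ∈ range (n + 1), p i| / |∑ i ∈ range (n + 1), p i|
      ≤ v + gamma v n ^ 2 * ((∑ i ∈ range (n + 1), |p i|) / |∑ i ∈ range (n + 1), p i|) := by
  have h := abs_compSum_sub_sum_le_gamma_sq hv hn p π q σ res hπ0 hπ hq hσ0 hσ hres
  set s := ∑ i ∈ range (n + 1), p i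
  set S := ∑ i ∈ range (n + 1), |p i|
  rcases eq_or_lt_of_le (abs_nonneg s) with hs | hs
  · rw [← hs]; simp [hv]
  · rw [div_le_iff₀ hs, add_mul, mul_assoc, div_mul_cancel₀ _ (ne_of_gt hs)]
    exact h

/-- PROPOSITION 4.7 ([8]; the same statement is [GraillatJezequel2020] PROPOSITION 4.4), trace
form: `FastCompSum` (Algorithm 3) under a directed rounding, where `FastTwoSum` returns a
correction with `|qᵢ - eᵢ| ≤ v |eᵢ|` (PROPOSITION 4.5, `v = 2u`): with `(n + 1) v < 1`,
`|res - s| ≤ v |s| + 2(1 + v) γₙ₊₁(v)² S` (printed `2u|s| + 2(1 + 2u) γₙ²(2u) S` for `n`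
summands with `nu < 1/2`).
[cite: GraillatJezequelPicot2018, §4.3 Proposition 4.7 with Proposition 4.5]
[cite: GraillatJezequel2020, §4.2 Proposition 4.4 eq. (6)] [cite: GraillatJezequelPicot2015] -/
theorem abs_fastCompSum_trace_sub_sum_le {v : K} (hv : 0 ≤ v) {n : ℕ}
    (hn : ((n + 1 : ℕ) : K) * v < 1) (p π q σ : ℕ → K) (res : K) (hπ0 : π 0 = p 0)
    (hπ : ∀ i < n, |π (i + 1) - (π i + p (i + 1))| ≤ v * |π i + p (i + 1)|)
    (hq : ∀ i < n, |q i - (π i + p (i + 1) - π (i + 1))| ≤ v * |π i + p (i + 1) - π (i + 1)|)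
    (hσ0 : σ 0 = 0) (hσ : ∀ i < n, |σ (i + 1) - (σ i + q i)| ≤ v * |σ i + q i|)
    (hres : |res - (π n + σ n)| ≤ v * |π n + σ n|) :
    |res - ∑ i ∈ range (n + 1), p i|
      ≤ v * |∑ i ∈ range (n + 1), p i|
        + 2 * (1 + v) * gamma v (n + 1) ^ 2 * ∑ i ∈ range (n + 1), |p i| := by
  have h := abs_compSum_sub_sum_le hv hv n p π q σ res hπ0 hπ hq hσ0 hσ hres
  have hp1 : (1 : K) ≤ (1 + v) ^ n := one_le_pow₀ (by linarith)
  have hg0 : 0 ≤ (1 + v) ^ n - 1 := by linarith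
  have hS0 : (0 : K) ≤ ∑ i ∈ range (n + 1), |p i| := Finset.sum_nonneg fun _ _ => abs_nonneg _
  have hG : (1 + v) ^ (n + 1) - 1 ≤ gamma v (n + 1) := one_add_pow_sub_one_le_gamma hv hn
  have hgG : (1 + v) ^ n - 1 ≤ (1 + v) ^ (n + 1) - 1 :=
    sub_le_sub_right (pow_le_pow_right₀ (by linarith) (Nat.le_succ n)) 1
  have hγ0 : 0 ≤ gamma v (n + 1) := gamma_nonneg hv hn
  refine le_trans h (add_le_add le_rfl ?_)
  have e : (1 + v) * (v + (1 + v) * ((1 + v) ^ n - 1)) * ((1 + v) ^ n - 1)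
      = (1 + v) * (((1 + v) ^ (n + 1) - 1) * ((1 + v) ^ n - 1)) := by ring
  rw [e]
  have h1 : ((1 + v) ^ (n + 1) - 1) * ((1 + v) ^ n - 1) ≤ gamma v (n + 1) * gamma v (n + 1) :=
    mul_le_mul hG (le_trans hgG hG) hg0 hγ0
  have h2 : (1 + v) * (((1 + v) ^ (n + 1) - 1) * ((1 + v) ^ n - 1))
      ≤ 2 * (1 + v) * gamma v (n + 1) ^ 2 := by
    have h3 := mul_le_mul_of_nonneg_left h1 (show (0 : K) ≤ 1 + v by linarith)
    nlinarith [mul_nonneg (show (0 : K) ≤ 1 + v by linarith) (mul_nonneg hγ0 hγ0)]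
  exact mul_le_mul_of_nonneg_right h2 hS0

/-- PROPOSITION 4.7 / [GraillatJezequel2020] PROPOSITION 4.4 LITERALLY for Algorithm 3 =
`GraillatJezequel2020.fastCompSum rd p n` (every operation rounded by one map `rd` with
`|rd t - t| ≤ v |t|`; the model `FastTwoSum` correction is `qᵢ = rd eᵢ`, PROPOSITION 4.5 in the
model): with `(n + 1) v < 1`, `|res - s| ≤ v |s| + 2(1 + v) γₙ₊₁(v)² S`.
[cite: GraillatJezequelPicot2018, §4.3 Proposition 4.7]
[cite: GraillatJezequel2020, §4.2 Algorithm 6 and Proposition 4.4] -/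
theorem abs_fastCompSum_sub_sum_le {rd : K → K} {v : K} (hv : 0 ≤ v) {n : ℕ}
    (hn : ((n + 1 : ℕ) : K) * v < 1) (hacc : ∀ t, |rd t - t| ≤ v * |t|) (p : ℕ → K) :
    |fastCompSum rd p n - ∑ i ∈ range (n + 1), p i|
      ≤ v * |∑ i ∈ range (n + 1), p i|
        + 2 * (1 + v) * gamma v (n + 1) ^ 2 * ∑ i ∈ range (n + 1), |p i| :=
  abs_fastCompSum_trace_sub_sum_le hv hn p (sumRd rd p) (fcsCorr rd p) (fcsSigma rd p)
    (fastCompSum rd p n) rfl (fun _ _ => hacc _) (fun _ _ => hacc _) rfl (fun _ _ => hacc _)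
    (hacc _)

/-- COROLLARY 4.8: the relative form of PROPOSITION 4.7,
`|res - s| / |s| ≤ v + 2(1 + v) γₙ₊₁(v)² cond(Σ pᵢ)` (`(n + 1) v < 1`; `0` on the left if
`s = 0`). [cite: GraillatJezequelPicot2018, §4.3 Corollary 4.8]
[cite: GraillatJezequel2020, §4.2 Corollary 4.5] -/
theorem abs_fastCompSum_sub_sum_div_le {rd : K → K} {v : K} (hv : 0 ≤ v) {n : ℕ}
    (hn : ((n + 1 : ℕ) : K) * v < 1) (hacc : ∀ t, |rd t - t| ≤ v * |t|) (p : ℕ → K) :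
    |fastCompSum rd p n - ∑ i ∈ range (n + 1), p i| / |∑ i ∈ range (n + 1), p i|
      ≤ v + 2 * (1 + v) * gamma v (n + 1) ^ 2
        * ((∑ i ∈ range (n + 1), |p i|) / |∑ i ∈ range (n + 1), p i|) := by
  have h := abs_fastCompSum_sub_sum_le hv hn hacc p
  set s := ∑ i ∈ range (n + 1), p i
  set S := ∑ i ∈ range (n + 1), |p i|
  rcases eq_or_lt_of_le (abs_nonneg s) with hs | hs
  · rw [← hs]; simp [hv]
  · rw [div_le_iff₀ hs, add_mul, mul_assoc, div_mul_cancel₀ _ (ne_of_gt hs)]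
    exact h

/-! ## Section 5.1, Proposition 5.1: the classic dot product under one rounding per operation -/

/-- PROPOSITION 5.1 ([11]), trace form: rounded products `|hᵢ - xᵢyᵢ| ≤ v |xᵢyᵢ|` accumulated
by `P₀ = h₀`, `|Pᵢ₊₁ - (Pᵢ + hᵢ₊₁)| ≤ v |Pᵢ + hᵢ₊₁|` (Algorithm 6): with `(n + 1) v < 1`,
`|res - xᵀy| ≤ γₙ₊₁(v) |x|ᵀ|y|`, `res = Pₙ` — eq. (5.13) for `v = u`, eq. (5.14) for `v = 2u`
(printed `γₙ` for `n` products). [cite: GraillatJezequelPicot2018, §5.1 Proposition 5.1]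
[cite: Higham2002ASNA, §3.1 eq. (3.5)] -/
theorem abs_dotTrace_sub_dot_le_gamma {v : K} (hv : 0 ≤ v) {n : ℕ}
    (hn : ((n + 1 : ℕ) : K) * v < 1) (x y h P : ℕ → K)
    (hh : ∀ i < n + 1, |h i - x i * y i| ≤ v * |x i * y i|) (hP0 : P 0 = h 0)
    (hP : ∀ i < n, |P (i + 1) - (P i + h (i + 1))| ≤ v * |P i + h (i + 1)|) :
    |P n - ∑ i ∈ range (n + 1), x i * y i|
      ≤ gamma v (n + 1) * ∑ i ∈ range (n + 1), |x i * y i| := by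
  have h1 := abs_acc_sub_le hv (h 0) (fun k => h (k + 1)) P hP0 n hP
  have e1 : h 0 + ∑ k ∈ range n, h (k + 1) = ∑ i ∈ range (n + 1), h i := by
    rw [Finset.sum_range_succ' h n, add_comm]
  have e2 : |h 0| + ∑ k ∈ range n, |h (k + 1)| = ∑ i ∈ range (n + 1), |h i| := by
    rw [Finset.sum_range_succ' (fun i => |h i|) n, add_comm]
  rw [e1, e2] at h1
  have hH : ∑ i ∈ range (n + 1), |h i| ≤ (1 + v) * ∑ i ∈ range (n + 1), |x i * y i| := by
    rw [Finset.mul_sum]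
    refine Finset.sum_le_sum fun i hi => ?_
    have h2 := hh i (Finset.mem_range.mp hi)
    have h3 := abs_add_le (h i - x i * y i) (x i * y i)
    rw [sub_add_cancel] at h3
    linarith
  have hΔ : |∑ i ∈ range (n + 1), h i - ∑ i ∈ range (n + 1), x i * y i|
      ≤ v * ∑ i ∈ range (n + 1), |x i * y i| := by
    rw [← Finset.sum_sub_distrib, Finset.mul_sum]
    exact le_trans (Finset.abs_sum_le_sum_abs _ _)
      (Finset.sum_le_sum fun i hi => hh i (Finset.mem_range.mp hi))
  set T := ∑ i ∈ range (n + 1), |x i * y i| with hT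
  have hT0 : 0 ≤ T := Finset.sum_nonneg fun _ _ => abs_nonneg _
  have hp1 : (1 : K) ≤ (1 + v) ^ n := one_le_pow₀ (by linarith)
  have hG : (1 + v) ^ (n + 1) - 1 ≤ gamma v (n + 1) := one_add_pow_sub_one_le_gamma hv hn
  have key : P n - ∑ i ∈ range (n + 1), x i * y i = (P n - ∑ i ∈ range (n + 1), h i)
      + (∑ i ∈ range (n + 1), h i - ∑ i ∈ range (n + 1), x i * y i) := by ring
  rw [key]
  calc |P n - ∑ i ∈ range (n + 1), h i
        + (∑ i ∈ range (n + 1), h i - ∑ i ∈ range (n + 1), x i * y i)|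
      ≤ |P n - ∑ i ∈ range (n + 1), h i|
          + |∑ i ∈ range (n + 1), h i - ∑ i ∈ range (n + 1), x i * y i| := abs_add_le _ _
    _ ≤ ((1 + v) ^ n - 1) * ((1 + v) * T) + v * T :=
        add_le_add (le_trans h1 (mul_le_mul_of_nonneg_left hH (by linarith))) hΔ
    _ = ((1 + v) ^ (n + 1) - 1) * T := by ring
    _ ≤ gamma v (n + 1) * T := mul_le_mul_of_nonneg_right hG hT0

/-! ## Sections 5.2–5.3: the compensated dot product (Algorithms 8/9), the common engine -/

/-- PROOFS OF PROPOSITIONS 5.3 AND 5.5, common trace form (eqs. (5.16)–(5.29)). Algorithm 9 on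
`(x₀, y₀) … (xₙ, yₙ)`: products `|hᵢ - xᵢyᵢ| ≤ v |xᵢyᵢ|` with EXACT residuals `rᵢ = xᵢyᵢ - hᵢ`
(`TwoProdFMA`, eqs. (5.16)–(5.17)), high parts `P₀ = h₀`, `|Pᵢ₊₁ - (Pᵢ + hᵢ₊₁)| ≤ v |Pᵢ + hᵢ₊₁|`
with exact errors `eᵢ = Pᵢ + hᵢ₊₁ - Pᵢ₊₁` and corrections `|qᵢ - eᵢ| ≤ w |eᵢ|` (eq. (5.18)),
line 5 `|cᵢ - (qᵢ + rᵢ₊₁)| ≤ v |qᵢ + rᵢ₊₁|`, `s₀ = r₀`, `|sᵢ₊₁ - (sᵢ + cᵢ)| ≤ v |sᵢ + cᵢ|`, result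
`|res - (Pₙ + sₙ)| ≤ v |Pₙ + sₙ|`. Then, with `g = (1 + v)ⁿ - 1`, `G = (1 + v)ⁿ⁺¹ - 1`,
`T = |x|ᵀ|y|`: `|res - xᵀy| ≤ v |xᵀy| + (1 + v)(G (v + (1 + w)(1 + v) g) + w (1 + v) g) T` — from
`xᵀy = Pₙ + r₀ + Σ (eᵢ + rᵢ₊₁)` (5.19), `Σ |rᵢ| ≤ v T` (5.20), `Σ |eᵢ| ≤ g (1 + v) T` (5.21),
`Σ |qᵢ| ≤ (1 + w) Σ |eᵢ|` (5.25), `|r₀ + Σ (qᵢ + rᵢ₊₁) - sₙ| ≤ G (|r₀| + Σ |qᵢ + rᵢ₊₁|)` (5.26–27;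
the printed (5.26) omits the term `Σ |fl(qᵢ + rᵢ) - (qᵢ + rᵢ)|`, which the factor `G` here
covers), and the final rounding.
[cite: GraillatJezequelPicot2018, §5.3 proof of Proposition 5.5, eqs. (5.16)–(5.29)]
[cite: OgitaRumpOishi2005] -/
theorem abs_compDot_sub_dot_le {v w : K} (hv : 0 ≤ v) (hw : 0 ≤ w) (n : ℕ)
    (x y h P q c s : ℕ → K) (res : K)
    (hh : ∀ i < n + 1, |h i - x i * y i| ≤ v * |x i * y i|) (hP0 : P 0 = h 0)
    (hP : ∀ i < n, |P (i + 1) - (P i + h (i + 1))| ≤ v * |P i + h (i + 1)|)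
    (hq : ∀ i < n, |q i - (P i + h (i + 1) - P (i + 1))| ≤ w * |P i + h (i + 1) - P (i + 1)|)
    (hc : ∀ i < n, |c i - (q i + (x (i + 1) * y (i + 1) - h (i + 1)))|
      ≤ v * |q i + (x (i + 1) * y (i + 1) - h (i + 1))|)
    (hs0 : s 0 = x 0 * y 0 - h 0) (hs : ∀ i < n, |s (i + 1) - (s i + c i)| ≤ v * |s i + c i|)
    (hres : |res - (P n + s n)| ≤ v * |P n + s n|) :
    |res - ∑ i ∈ range (n + 1), x i * y i|
      ≤ v * |∑ i ∈ range (n + 1), x i * y i|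
        + (1 + v) * (((1 + v) ^ (n + 1) - 1) * (v + (1 + w) * (1 + v) * ((1 + v) ^ n - 1))
            + w * (1 + v) * ((1 + v) ^ n - 1)) * ∑ i ∈ range (n + 1), |x i * y i| := by
  -- (5.16)–(5.19): `xᵀy = Pₙ + (r₀ + Σ (eᵢ + rᵢ₊₁))` with `rᵢ = xᵢyᵢ - hᵢ`
  have hid : ∑ i ∈ range (n + 1), x i * y i = P n + ((x 0 * y 0 - h 0)
      + ∑ i ∈ range n, (P i + h (i + 1) - P (i + 1) + (x (i + 1) * y (i + 1) - h (i + 1)))) :=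
    dot_eq_compDot_trace x y h (fun i => x i * y i - h i) P hP0 n (fun i _ => by ring)
  have hE := sum_abs_err_le hv h P hP0 n hP
  set d := ∑ i ∈ range (n + 1), x i * y i with hd
  set T := ∑ i ∈ range (n + 1), |x i * y i| with hT
  set g := (1 + v) ^ n - 1 with hg
  set G := (1 + v) ^ (n + 1) - 1 with hG
  set E := ∑ i ∈ range n, |P i + h (i + 1) - P (i + 1)| with hEdef
  set Q := ∑ i ∈ range n, |q i + (x (i + 1) * y (i + 1) - h (i + 1))| with hQ
  have hp1 : (1 : K) ≤ (1 + v) ^ n := one_le_pow₀ (by linarith)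
  have hg0 : 0 ≤ g := by rw [hg]; linarith
  have egG : (1 + v) * g + v = G := by rw [hg, hG]; ring
  have hgG : g ≤ G := by nlinarith [mul_nonneg hv hg0]
  have hG0 : 0 ≤ G := le_trans hg0 hgG
  have hT0 : 0 ≤ T := Finset.sum_nonneg fun _ _ => abs_nonneg _
  -- (5.20): `|r₀| + Σ |rᵢ₊₁| = Σ |rᵢ| ≤ v T`
  have hR : |x 0 * y 0 - h 0| + ∑ i ∈ range n, |x (i + 1) * y (i + 1) - h (i + 1)| ≤ v * T := by
    have e1 : |x 0 * y 0 - h 0| + ∑ i ∈ range n, |x (i + 1) * y (i + 1) - h (i + 1)|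
        = ∑ i ∈ range (n + 1), |x i * y i - h i| := by
      rw [Finset.sum_range_succ' (fun i => |x i * y i - h i|) n, add_comm]
    rw [e1, hT, Finset.mul_sum]
    refine Finset.sum_le_sum fun i hi => ?_
    rw [abs_sub_comm]; exact hh i (Finset.mem_range.mp hi)
  -- (5.21): `Σ |hᵢ| ≤ (1 + v) T`, so `Σ |eᵢ| ≤ g (1 + v) T` (Lemma 4.6 on the high parts)
  have hH : ∑ i ∈ range (n + 1), |h i| ≤ (1 + v) * T := by
    rw [hT, Finset.mul_sum]
    refine Finset.sum_le_sum fun i hi => ?_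
    have h2 := hh i (Finset.mem_range.mp hi)
    have h3 := abs_add_le (h i - x i * y i) (x i * y i)
    rw [sub_add_cancel] at h3
    linarith
  have hE' : E ≤ g * ((1 + v) * T) := le_trans hE (mul_le_mul_of_nonneg_left hH hg0)
  -- (5.23)–(5.25)
  have hqe : ∑ i ∈ range n, |q i - (P i + h (i + 1) - P (i + 1))| ≤ w * E :=
    (sum_abs_corr_le n q (fun i => P i + h (i + 1) - P (i + 1)) hq).1
  have hqabs : ∑ i ∈ range n, |q i| ≤ (1 + w) * E :=
    (sum_abs_corr_le n q (fun i => P i + h (i + 1) - P (i + 1)) hq).2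
  -- line 5: `cᵢ = fl(qᵢ + rᵢ₊₁)`, `sᵢ₊₁ = fl(sᵢ + cᵢ)` (eq. (5.26) and the two displays after it)
  have hcq : ∑ i ∈ range n, |c i - (q i + (x (i + 1) * y (i + 1) - h (i + 1)))| ≤ v * Q :=
    (sum_abs_corr_le n c (fun i => q i + (x (i + 1) * y (i + 1) - h (i + 1))) hc).1
  have hcabs : ∑ i ∈ range n, |c i| ≤ (1 + v) * Q :=
    (sum_abs_corr_le n c (fun i => q i + (x (i + 1) * y (i + 1) - h (i + 1))) hc).2
  have hsacc : |s n - (x 0 * y 0 - h 0 + ∑ i ∈ range n, c i)|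
      ≤ g * (|x 0 * y 0 - h 0| + ∑ i ∈ range n, |c i|) := abs_acc_sub_le hv _ c s hs0 n hs
  -- (5.27): `|sₙ - (r₀ + Σ (qᵢ + rᵢ₊₁))| ≤ G (|r₀| + Q)`
  have h527 : |s n - (x 0 * y 0 - h 0
      + ∑ i ∈ range n, (q i + (x (i + 1) * y (i + 1) - h (i + 1))))|
      ≤ G * (|x 0 * y 0 - h 0| + Q) := by
    have hsplit : ∑ i ∈ range n, (c i - (q i + (x (i + 1) * y (i + 1) - h (i + 1))))
        = ∑ i ∈ range n, c i - ∑ i ∈ range n, (q i + (x (i + 1) * y (i + 1) - h (i + 1))) :=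
      Finset.sum_sub_distrib _ _
    have e1 : s n - (x 0 * y 0 - h 0
        + ∑ i ∈ range n, (q i + (x (i + 1) * y (i + 1) - h (i + 1))))
        = (s n - (x 0 * y 0 - h 0 + ∑ i ∈ range n, c i))
          + ∑ i ∈ range n, (c i - (q i + (x (i + 1) * y (i + 1) - h (i + 1)))) := by
      linear_combination (-1 : K) * hsplit
    rw [e1]
    calc |s n - (x 0 * y 0 - h 0 + ∑ i ∈ range n, c i)
          + ∑ i ∈ range n, (c i - (q i + (x (i + 1) * y (i + 1) - h (i + 1))))|
        ≤ |s n - (x 0 * y 0 - h 0 + ∑ i ∈ range n, c i)|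
            + |∑ i ∈ range n, (c i - (q i + (x (i + 1) * y (i + 1) - h (i + 1))))| :=
          abs_add_le _ _
      _ ≤ g * (|x 0 * y 0 - h 0| + ∑ i ∈ range n, |c i|)
            + ∑ i ∈ range n, |c i - (q i + (x (i + 1) * y (i + 1) - h (i + 1)))| :=
          add_le_add hsacc (Finset.abs_sum_le_sum_abs _ _)
      _ ≤ g * (|x 0 * y 0 - h 0| + (1 + v) * Q) + v * Q :=
          add_le_add (mul_le_mul_of_nonneg_left (add_le_add le_rfl hcabs) hg0) hcq
      _ = g * |x 0 * y 0 - h 0| + ((1 + v) * g + v) * Q := by ring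
      _ ≤ G * |x 0 * y 0 - h 0| + G * Q := by
          rw [egG]
          exact add_le_add (mul_le_mul_of_nonneg_right hgG (abs_nonneg _)) le_rfl
      _ = G * (|x 0 * y 0 - h 0| + Q) := by ring
  -- `|r₀| + Q ≤ v T + (1 + w) Σ |eᵢ|` (eqs. (5.20), (5.25))
  have hRQ : |x 0 * y 0 - h 0| + Q ≤ v * T + (1 + w) * (g * ((1 + v) * T)) := by
    have hQle : Q ≤ ∑ i ∈ range n, |q i|
        + ∑ i ∈ range n, |x (i + 1) * y (i + 1) - h (i + 1)| := by
      rw [hQ, ← Finset.sum_add_distrib]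
      exact Finset.sum_le_sum fun i _ => abs_add_le _ _
    have h1w : (0 : K) ≤ 1 + w := by linarith
    linarith [hQle, hR, hqabs, mul_le_mul_of_nonneg_left hE' h1w]
  -- (5.28): `|xᵀy - Pₙ - sₙ| ≤ G (|r₀| + Q) + Σ |eᵢ - qᵢ|`
  have hD : |P n + s n - d|
      ≤ G * (v * T + (1 + w) * (g * ((1 + v) * T))) + w * (g * ((1 + v) * T)) := by
    have hA : ∑ i ∈ range n, (q i + (x (i + 1) * y (i + 1) - h (i + 1)))
        = ∑ i ∈ range n, q i + ∑ i ∈ range n, (x (i + 1) * y (i + 1) - h (i + 1)) :=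
      Finset.sum_add_distrib
    have hB : ∑ i ∈ range n, (q i - (P i + h (i + 1) - P (i + 1)))
        = ∑ i ∈ range n, q i - ∑ i ∈ range n, (P i + h (i + 1) - P (i + 1)) :=
      Finset.sum_sub_distrib _ _
    have hC : ∑ i ∈ range n, (P i + h (i + 1) - P (i + 1) + (x (i + 1) * y (i + 1) - h (i + 1)))
        = ∑ i ∈ range n, (P i + h (i + 1) - P (i + 1))
          + ∑ i ∈ range n, (x (i + 1) * y (i + 1) - h (i + 1)) :=
      Finset.sum_add_distrib
    have e1 : P n + s n - d = (s n - (x 0 * y 0 - h 0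
        + ∑ i ∈ range n, (q i + (x (i + 1) * y (i + 1) - h (i + 1)))))
        + ∑ i ∈ range n, (q i - (P i + h (i + 1) - P (i + 1))) := by
      linear_combination (-1 : K) * hid + hA - hB - hC
    rw [e1]
    calc |s n - (x 0 * y 0 - h 0 + ∑ i ∈ range n, (q i + (x (i + 1) * y (i + 1) - h (i + 1))))
          + ∑ i ∈ range n, (q i - (P i + h (i + 1) - P (i + 1)))|
        ≤ |s n - (x 0 * y 0 - h 0 + ∑ i ∈ range n, (q i + (x (i + 1) * y (i + 1) - h (i + 1))))|
            + |∑ i ∈ range n, (q i - (P i + h (i + 1) - P (i + 1)))| := abs_add_le _ _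
      _ ≤ G * (|x 0 * y 0 - h 0| + Q) + ∑ i ∈ range n, |q i - (P i + h (i + 1) - P (i + 1))| :=
          add_le_add h527 (Finset.abs_sum_le_sum_abs _ _)
      _ ≤ G * (v * T + (1 + w) * (g * ((1 + v) * T))) + w * (g * ((1 + v) * T)) :=
          add_le_add (mul_le_mul_of_nonneg_left hRQ hG0)
            (le_trans hqe (mul_le_mul_of_nonneg_left hE' hw))
  -- the final rounding
  have hfin : |P n + s n| ≤ |d| + |P n + s n - d| := by
    have e : |P n + s n| = |d + (P n + s n - d)| := by congr 1; ring
    rw [e]; exact abs_add_le _ _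
  have key : res - d = (res - (P n + s n)) + (P n + s n - d) := by ring
  rw [key]
  calc |res - (P n + s n) + (P n + s n - d)|
      ≤ |res - (P n + s n)| + |P n + s n - d| := abs_add_le _ _
    _ ≤ v * (|d| + |P n + s n - d|) + |P n + s n - d| :=
        add_le_add (le_trans hres (mul_le_mul_of_nonneg_left hfin hv)) le_rfl
    _ = v * |d| + (1 + v) * |P n + s n - d| := by ring
    _ ≤ v * |d| + (1 + v) * (G * (v * T + (1 + w) * (g * ((1 + v) * T)))
        + w * (g * ((1 + v) * T))) := add_le_add le_rfl (mul_le_mul_of_nonneg_left hD (by linarith))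
    _ = v * |d| + (1 + v) * (G * (v + (1 + w) * (1 + v) * g) + w * (1 + v) * g) * T := by ring

/-- PROPOSITION 5.3 ([20]; eq. (5.15)), trace form: `CompDot` (Algorithm 8) under rounding to
nearest (`v = u`), where `TwoProdFMA` and `FastTwoSum`/`TwoSum` are EXACT (`qᵢ = eᵢ`): with
`(n + 1) v < 1`, `|res - xᵀy| ≤ v |xᵀy| + γₙ₊₁(v)² |x|ᵀ|y|` (printed `γₙ²(u)` for `n` products,
`nu < 1`). [cite: GraillatJezequelPicot2018, §5.2 Proposition 5.3 eq. (5.15)]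
[cite: OgitaRumpOishi2005] -/
theorem abs_compDot_sub_dot_le_gamma_sq {v : K} (hv : 0 ≤ v) {n : ℕ}
    (hn : ((n + 1 : ℕ) : K) * v < 1) (x y h P q c s : ℕ → K) (res : K)
    (hh : ∀ i < n + 1, |h i - x i * y i| ≤ v * |x i * y i|) (hP0 : P 0 = h 0)
    (hP : ∀ i < n, |P (i + 1) - (P i + h (i + 1))| ≤ v * |P i + h (i + 1)|)
    (hq : ∀ i < n, q i = P i + h (i + 1) - P (i + 1))
    (hc : ∀ i < n, |c i - (q i + (x (i + 1) * y (i + 1) - h (i + 1)))|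
      ≤ v * |q i + (x (i + 1) * y (i + 1) - h (i + 1))|)
    (hs0 : s 0 = x 0 * y 0 - h 0) (hs : ∀ i < n, |s (i + 1) - (s i + c i)| ≤ v * |s i + c i|)
    (hres : |res - (P n + s n)| ≤ v * |P n + s n|) :
    |res - ∑ i ∈ range (n + 1), x i * y i|
      ≤ v * |∑ i ∈ range (n + 1), x i * y i|
        + gamma v (n + 1) ^ 2 * ∑ i ∈ range (n + 1), |x i * y i| := by
  have h0 := abs_compDot_sub_dot_le hv le_rfl n x y h P q c s res hh hP0 hP
    (fun i hi => by rw [hq i hi, sub_self, abs_zero, zero_mul]) hc hs0 hs hres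
  have hp1 : (1 : K) ≤ (1 + v) ^ (n + 1) := one_le_pow₀ (by linarith)
  have hG0 : 0 ≤ (1 + v) ^ (n + 1) - 1 := by linarith
  have hT0 : (0 : K) ≤ ∑ i ∈ range (n + 1), |x i * y i| :=
    Finset.sum_nonneg fun _ _ => abs_nonneg _
  have h1 : (1 + v) * ((1 + v) ^ (n + 1) - 1) ≤ gamma v (n + 1) :=
    one_add_mul_pow_sub_one_le_gamma hv hn
  have h2 : (1 + v) ^ (n + 1) - 1 ≤ gamma v (n + 1) := one_add_pow_sub_one_le_gamma hv hn
  refine le_trans h0 (add_le_add le_rfl ?_)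
  have e : (1 + v) * (((1 + v) ^ (n + 1) - 1) * (v + (1 + 0) * (1 + v) * ((1 + v) ^ n - 1))
      + 0 * (1 + v) * ((1 + v) ^ n - 1))
      = ((1 + v) * ((1 + v) ^ (n + 1) - 1)) * ((1 + v) ^ (n + 1) - 1) := by ring
  rw [e, sq]
  exact mul_le_mul_of_nonneg_right (mul_le_mul h1 h2 hG0 (gamma_nonneg hv hn)) hT0

/-- COROLLARY 5.4 ([20]): the relative form of PROPOSITION 5.3,
`|res - xᵀy| / |xᵀy| ≤ v + γₙ₊₁(v)² |x|ᵀ|y| / |xᵀy| = v + ½ γₙ₊₁(v)² cond(xᵀy)` with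
`cond(xᵀy) = 2 |x|ᵀ|y| / |xᵀy|` (`0` on the left if `xᵀy = 0`).
[cite: GraillatJezequelPicot2018, §5.2 Corollary 5.4] [cite: OgitaRumpOishi2005] -/
theorem abs_compDot_sub_dot_div_le {v : K} (hv : 0 ≤ v) {n : ℕ}
    (hn : ((n + 1 : ℕ) : K) * v < 1) (x y h P q c s : ℕ → K) (res : K)
    (hh : ∀ i < n + 1, |h i - x i * y i| ≤ v * |x i * y i|) (hP0 : P 0 = h 0)
    (hP : ∀ i < n, |P (i + 1) - (P i + h (i + 1))| ≤ v * |P i + h (i + 1)|)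
    (hq : ∀ i < n, q i = P i + h (i + 1) - P (i + 1))
    (hc : ∀ i < n, |c i - (q i + (x (i + 1) * y (i + 1) - h (i + 1)))|
      ≤ v * |q i + (x (i + 1) * y (i + 1) - h (i + 1))|)
    (hs0 : s 0 = x 0 * y 0 - h 0) (hs : ∀ i < n, |s (i + 1) - (s i + c i)| ≤ v * |s i + c i|)
    (hres : |res - (P n + s n)| ≤ v * |P n + s n|) :
    |res - ∑ i ∈ range (n + 1), x i * y i| / |∑ i ∈ range (n + 1), x i * y i|
      ≤ v + gamma v (n + 1) ^ 2
        * ((∑ i ∈ range (n + 1), |x i * y i|) / |∑ i ∈ range (n + 1), x i * y i|) := by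
  have h0 := abs_compDot_sub_dot_le_gamma_sq hv hn x y h P q c s res hh hP0 hP hq hc hs0 hs hres
  set d := ∑ i ∈ range (n + 1), x i * y i
  set T := ∑ i ∈ range (n + 1), |x i * y i|
  rcases eq_or_lt_of_le (abs_nonneg d) with hd | hd
  · rw [← hd]; simp [hv]
  · rw [div_le_iff₀ hd, add_mul, mul_assoc, div_mul_cancel₀ _ (ne_of_gt hd)]
    exact h0

/-- PROPOSITION 5.5 (the same bound is [GraillatJezequel2020] PROPOSITION 5.4, there for the
`TwoSum` variant), trace form: `CompDot` (Algorithms 8/9) under a directed rounding (`v = 2u`),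
`TwoProdFMA` exact, `FastTwoSum` returning `|qᵢ - eᵢ| ≤ v |eᵢ|` (eq. (5.18), PROPOSITION 4.5):
with `(n + 2) v < 1`, `|res - xᵀy| ≤ v |xᵀy| + 2 γₙ₊₂(v)² |x|ᵀ|y|` (printed
`2u |xᵀy| + 2 γ²ₙ₊₁(2u) |x|ᵀ|y|` for `n` products with `(n + 1)u < 1/2`; the proof here reaches
`2 γₙ₊₁(v)²` and weakens by REMARK 1).
[cite: GraillatJezequelPicot2018, §5.3 Proposition 5.5]
[cite: GraillatJezequel2020, §5.2 Proposition 5.4] -/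
theorem abs_compDotDir_sub_dot_le {v : K} (hv : 0 ≤ v) {n : ℕ} (hn : ((n + 2 : ℕ) : K) * v < 1)
    (x y h P q c s : ℕ → K) (res : K)
    (hh : ∀ i < n + 1, |h i - x i * y i| ≤ v * |x i * y i|) (hP0 : P 0 = h 0)
    (hP : ∀ i < n, |P (i + 1) - (P i + h (i + 1))| ≤ v * |P i + h (i + 1)|)
    (hq : ∀ i < n, |q i - (P i + h (i + 1) - P (i + 1))| ≤ v * |P i + h (i + 1) - P (i + 1)|)
    (hc : ∀ i < n, |c i - (q i + (x (i + 1) * y (i + 1) - h (i + 1)))|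
      ≤ v * |q i + (x (i + 1) * y (i + 1) - h (i + 1))|)
    (hs0 : s 0 = x 0 * y 0 - h 0) (hs : ∀ i < n, |s (i + 1) - (s i + c i)| ≤ v * |s i + c i|)
    (hres : |res - (P n + s n)| ≤ v * |P n + s n|) :
    |res - ∑ i ∈ range (n + 1), x i * y i|
      ≤ v * |∑ i ∈ range (n + 1), x i * y i|
        + 2 * gamma v (n + 2) ^ 2 * ∑ i ∈ range (n + 1), |x i * y i| := by
  have h0 := abs_compDot_sub_dot_le hv hv n x y h P q c s res hh hP0 hP hq hc hs0 hs hres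
  have hn1 : ((n + 1 : ℕ) : K) * v < 1 := by push_cast at hn ⊢; nlinarith
  have hp1 : (1 : K) ≤ (1 + v) ^ (n + 1) := one_le_pow₀ (by linarith)
  have hG0 : 0 ≤ (1 + v) ^ (n + 1) - 1 := by linarith
  have hT0 : (0 : K) ≤ ∑ i ∈ range (n + 1), |x i * y i| :=
    Finset.sum_nonneg fun _ _ => abs_nonneg _
  have ha : (1 + v) * ((1 + v) ^ (n + 1) - 1) ≤ gamma v (n + 1) :=
    one_add_mul_pow_sub_one_le_gamma hv hn1
  have ha0 : 0 ≤ (1 + v) * ((1 + v) ^ (n + 1) - 1) := mul_nonneg (by linarith) hG0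
  have hγ0 : 0 ≤ gamma v (n + 1) := gamma_nonneg hv hn1
  have hvγ : v ≤ gamma v (n + 1) := by
    have h1 := mul_le_gamma hv hn1
    push_cast at h1
    nlinarith [mul_nonneg (Nat.cast_nonneg n) hv]
  have hmono : gamma v (n + 1) ≤ gamma v (n + 2) := gamma_le_gamma_succ hv hn
  refine le_trans h0 (add_le_add le_rfl ?_)
  -- `(1 + v)(G (v + (1 + v)² g) + v (1 + v) g) + v² (1 + v)ⁿ⁺² = a² + v a`, `a = (1 + v) G`
  have e : (1 + v) * (((1 + v) ^ (n + 1) - 1) * (v + (1 + v) * (1 + v) * ((1 + v) ^ n - 1))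
        + v * (1 + v) * ((1 + v) ^ n - 1)) + v ^ 2 * (1 + v) ^ (n + 2)
      = ((1 + v) * ((1 + v) ^ (n + 1) - 1)) * ((1 + v) * ((1 + v) ^ (n + 1) - 1))
        + v * ((1 + v) * ((1 + v) ^ (n + 1) - 1)) := by
    ring
  have h4 : 0 ≤ v ^ 2 * (1 + v) ^ (n + 2) := by positivity
  have h3 : (1 + v) * (((1 + v) ^ (n + 1) - 1) * (v + (1 + v) * (1 + v) * ((1 + v) ^ n - 1))
        + v * (1 + v) * ((1 + v) ^ n - 1)) ≤ 2 * gamma v (n + 2) ^ 2 := by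
    nlinarith [e, h4, mul_le_mul ha ha ha0 hγ0, mul_le_mul_of_nonneg_left ha hv,
      mul_le_mul hvγ le_rfl hγ0 hγ0, mul_le_mul hmono hmono hγ0 (le_trans hγ0 hmono)]
  exact mul_le_mul_of_nonneg_right h3 hT0

/-- PROPOSITION 5.5 LITERALLY for Algorithm 8 = `GraillatJezequel2020.compDotRd rd cr x y n` (every
operation rounded by one map `rd` with `|rd t - t| ≤ v |t|`, `TwoProdFMA` residual exact, and the
model `FastTwoSum` correction `cr a b = rd (a + b - rd (a + b))`, PROPOSITION 4.5 in the model):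
with `(n + 2) v < 1`, `|res - xᵀy| ≤ v |xᵀy| + 2 γₙ₊₂(v)² |x|ᵀ|y|`.
[cite: GraillatJezequelPicot2018, §5.3 Proposition 5.5 and Algorithms 8–9]
[cite: GraillatJezequel2020, §5.2 Algorithm 10 and Proposition 5.4] -/
theorem abs_compDotRd_sub_dot_le {rd : K → K} {cr : K → K → K} {v : K} (hv : 0 ≤ v) {n : ℕ}
    (hn : ((n + 2 : ℕ) : K) * v < 1) (hacc : ∀ t, |rd t - t| ≤ v * |t|)
    (hcr : ∀ a b, cr a b = rd (a + b - rd (a + b))) (x y : ℕ → K) :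
    |compDotRd rd cr x y n - ∑ i ∈ range (n + 1), x i * y i|
      ≤ v * |∑ i ∈ range (n + 1), x i * y i|
        + 2 * gamma v (n + 2) ^ 2 * ∑ i ∈ range (n + 1), |x i * y i| :=
  abs_compDotDir_sub_dot_le hv hn x y (fun i => rd (x i * y i)) (dotRd rd x y)
    (fun i => cr (dotRd rd x y i) (rd (x (i + 1) * y (i + 1))))
    (fun i => rd (cr (dotRd rd x y i) (rd (x (i + 1) * y (i + 1)))
      + (x (i + 1) * y (i + 1) - rd (x (i + 1) * y (i + 1)))))
    (cdS rd cr x y) (compDotRd rd cr x y n) (fun _ _ => hacc _) rfl (fun _ _ => hacc _)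
    (fun i _ => by simp only [hcr]; exact hacc _) (fun _ _ => hacc _) rfl (fun _ _ => hacc _)
    (hacc _)

/-- COROLLARY 5.6: the relative form of PROPOSITION 5.5 for Algorithm 8,
`|res - xᵀy| / |xᵀy| ≤ v + γₙ₊₂(v)² cond(xᵀy)`, `cond(xᵀy) = 2 |x|ᵀ|y| / |xᵀy|` (`(n + 2) v < 1`;
`0` on the left if `xᵀy = 0`). [cite: GraillatJezequelPicot2018, §5.3 Corollary 5.6]
[cite: GraillatJezequel2020, §5.2 Corollary 5.5] -/
theorem abs_compDotRd_sub_dot_div_le {rd : K → K} {cr : K → K → K} {v : K} (hv : 0 ≤ v)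
    {n : ℕ} (hn : ((n + 2 : ℕ) : K) * v < 1) (hacc : ∀ t, |rd t - t| ≤ v * |t|)
    (hcr : ∀ a b, cr a b = rd (a + b - rd (a + b))) (x y : ℕ → K) :
    |compDotRd rd cr x y n - ∑ i ∈ range (n + 1), x i * y i| / |∑ i ∈ range (n + 1), x i * y i|
      ≤ v + gamma v (n + 2) ^ 2
        * (2 * (∑ i ∈ range (n + 1), |x i * y i|) / |∑ i ∈ range (n + 1), x i * y i|) := by
  have h0 := abs_compDotRd_sub_dot_le hv hn hacc hcr x y
  set d := ∑ i ∈ range (n + 1), x i * y i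
  set T := ∑ i ∈ range (n + 1), |x i * y i|
  rcases eq_or_lt_of_le (abs_nonneg d) with hd | hd
  · rw [← hd]; simp [hv]
  · rw [div_le_iff₀ hd, add_mul, mul_div_assoc', div_mul_cancel₀ _ (ne_of_gt hd)]
    linarith [h0]

end Literature.ComputerArithmetic.GraillatJezequelPicot2018
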